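import Summits.CriticalPhenomena.CardyFormulaZ2.Theorems.CardyComplexConeEdgePrecompactUFRSStrands
import Summits.CriticalPhenomena.CardyFormulaZ2.Theorems.CardyComplexConeEdgePrecompactCollarAgreement

/-!
# Structure of a forward-response failure: collar localisation and the finite second run
(line `qkz-strip-boundary-arm` of crux `CardyComplexCone.EdgePrecompact`, stmt-CriticalPhenomena-11387;
items 1–3 of the road map for the uniform forward response stability "UFRS", module docstring of
`Theorems/CardyComplexConeEdgePrecompactUniformForwardResponseStability.lean`, assembled in the
concrete setting of UFRS)

For a Dobrushin domain `D` and `η > 0` there is `δ₀ > 0` such that for every `ℤ²`-admissible datum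
`E` of `D` with mesh `E.δ < δ₀`, every lattice shift `w` with `‖E.δ w‖ < η`, every ball
`B = B(E.δ v, ρ)` with `4η ≤ ρ` and `2ρ ≤ dist(E.δ v, Dᶜ)`, every configuration `ω` and every
admissible pair of corners `(a, a')` (the two start corners of `E` and `E₁ = shiftData E w`, or a
common exit corner of `B`) whose FORWARD RESPONSE FAILS (the event of UFRS), the failure has the
following structure (`ufrs_failureStructure`, registered sub-goal), with `β₀ = E.bcBondConfig ω`,
`β₁ = E₁.bcBondConfig ω`, `Oᵢ = cornerOrbit βᵢ`: there is a re-entry time `n` of the `β₀`-orbit of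
`a` into `B` through inner faces such that EITHER
* INITIAL: `(a, a')` is the START pair and no index `m ≤ n` is synchronised (the re-rooting at the
  marked point `a_δ`; impossible for an exit corner, `responseLocalisation_diag`), OR
* LOCALISED: there is a last synchronised index `m < n` (reached by the `β₁`-orbit of `a'` at time `k`
  through inner faces avoiding `B`, same corner `e = O₀ a m = O₁ a' k`, same turning sum) whose corner
  lies in the COLLAR — `dist(E.δ e.1, Dᶜ) < 3η` (by `collarAgreement` / `no_discrepancy_of_agree` the
  two dynamics and the two inner-face predicates coincide at `3η`-deep corners) — followed by a FACE
  discrepancy or by a SPLIT discrepancy (clauses of `responseLocalisation`), and in the SPLIT case the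
  `β₁`-orbit of `e` has a RUN END `T` (`exists_runEnd`: a good stretch `O₁ e [0, T]` then entry into
  `B` or exit from the inner faces of `E₁` — no idle cycling, since `a'` is a start corner or an exit
  corner of `B` and the inner corners of `E₁` are finitely many), so that `splitStrands`
  (`…EdgePrecompactUFRSStrands.lean`) applies verbatim and yields the three strands at `cTgt e`
  (case (A)) or the bigon with a turning mismatch (case (B)), each strand carrying an open arm on its
  left and a dual arm on its right (`exists_orbitArms`).

What is NOT here (items 3–6 of the road map, planar topology and probability): that the strands,
restricted to the annulus `A(e; 3η, ρ/2)`, give arms with the disjointness of `zdDomArmEvent` /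
`Z2HalfPlane.threeArm`, and the summation over collar boxes.

References: S. Smirnov, C. R. Acad. Sci. Paris 333 (2001), §2; G. Grimmett, *Percolation* (1999),
§11.2; P. Nolin, Electron. J. Probab. 13 (2008), §4.
-/

namespace Summit.CriticalPhenomena.CardyFormulaZ2.Cruxes.EdgePrecompact.QkzStripBoundaryArm

open MeasureTheory Filter Set Metric
open scoped Topology BigOperators Pointwise
open Literature.Probability.LatticeModels Literature.Probability.Percolation
open Literature.Probability.RandomPlanarGeometry (DobrushinDomain)
open Summit.CriticalPhenomena.CardyFormulaZ2.Theses.CardyComplexCone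

noncomputable section

/-! ## Depth of the ball's exit corners -/

/-- A corner whose source edge has its midpoint in the ball `B(E.δ v, ρ)` has its vertex within
`ρ + E.δ` of the centre, hence at depth `≥ 2ρ - ρ - E.δ ≥ 3η` when the centre is `2ρ`-deep,
`4η ≤ ρ` and `E.δ ≤ η`. -/
theorem deep_of_cSrc_mem_ball {E : DiscreteDobrushin} {Ω : Set ℂ} {v : Site 2} {ρ η : ℝ}
    (hδ : 0 ≤ E.δ) (hδη : E.δ ≤ η) (hηρ : 4 * η ≤ ρ) (hv : 2 * ρ ≤ infDist (meshPoint E.δ v) Ωᶜ)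
    {a : Site 2 × Fin 4} (ha : medialPoint E.δ (cSrc a) ∈ ball (meshPoint E.δ v) ρ) :
    3 * η ≤ infDist (meshPoint E.δ a.1) Ωᶜ := by
  have h1 := dist_medialPoint_cSrc_le' hδ a
  have h2 := dist_triangle (meshPoint E.δ a.1) (medialPoint E.δ (cSrc a)) (meshPoint E.δ v)
  rw [dist_comm] at h1
  rw [mem_ball] at ha
  have h3 := infDist_le_infDist_add_dist (x := meshPoint E.δ v) (y := meshPoint E.δ a.1) (s := Ωᶜ)
  rw [dist_comm] at h3
  linarith

/-! ## The structure theorem -/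

/-- **Structure of a forward-response failure** (registered sub-goal `ufrs_failureStructure` of
stmt-CriticalPhenomena-11387; items 1–3 of the UFRS road map in the concrete setting). For `η > 0`
there is `δ₀ > 0` such that for every admissible datum `E` of `D` with `E.δ < δ₀`, shift `w` with
`‖E.δ w‖ < η`, ball `B(E.δ v, ρ)` with `4η ≤ ρ`, `2ρ ≤ infDist (E.δ v) Dᶜ`, configuration `ω` and
admissible pair `(a, a')` whose forward response fails: there is a re-entry time `n` (good
`β₀`-stretch of `a`, target at `n` in the ball) with EITHER the INITIAL discrepancy of the START pair,
OR a last synchronised corner `e = O₀ a m = O₁ a' k`, `m < n`, IN THE `3η`-COLLAR, followed by a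
FACE discrepancy or by a SPLIT discrepancy together with a run end `T` of the `β₁`-orbit of `e`. -/
theorem ufrs_failureStructure : ∀ (D : DobrushinDomain) (η : ℝ), 0 < η → ∃ δ₀ > (0:ℝ), ∀ E : DiscreteDobrushin, E.Ω = D.carrier → E.IsZdAdmissible → E.δ < δ₀ → ∀ (v w : Site 2) (ρ : ℝ), 4 * η ≤ ρ → 2 * ρ ≤ infDist (meshPoint E.δ v) D.carrierᶜ → ‖meshPoint E.δ w‖ < η → ∀ (ω : BondConfig (Site 2)) (a a' : Site 2 × Fin 4) (E₁ : DiscreteDobrushin) (β₀ β₁ : BondConfig (Site 2)) (I : Set (Sym2 (Site 2))), E₁ = shiftData E w → β₀ = E.bcBondConfig ω → β₁ = E₁.bcBondConfig ω → I = {e | medialPoint E.δ e ∈ ball (meshPoint E.δ v) ρ} → ((E.IsStartCorner a ∧ E₁.IsStartCorner a') ∨ (a = a' ∧ medialPoint E.δ (cSrc a) ∈ ball (meshPoint E.δ v) ρ ∧ cTgt a ∉ I)) → (¬ ∀ n : ℕ, (∀ i < n, cTgt (cornerOrbit β₀ a i) ∉ I ∧ E.IsInnerFace (cFace (cornerOrbit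 β₀ a (i + 1)))) → cTgt (cornerOrbit β₀ a n) ∈ I → ∃ n' : ℕ, (∀ i < n', cTgt (cornerOrbit β₁ a' i) ∉ I ∧ E₁.IsInnerFace (cFace (cornerOrbit β₁ a' (i + 1)))) ∧ cornerOrbit β₁ a' n' = cornerOrbit β₀ a n ∧ ∑ i ∈ Finset.range n', turnOf β₁ (cornerOrbit β₁ a' i) = ∑ i ∈ Finset.range n, turnOf β₀ (cornerOrbit β₀ a i)) → ∃ n : ℕ, (∀ i < n, cTgt (cornerOrbit β₀ a i) ∉ I ∧ E.IsInnerFace (cFace (cornerOrbit β₀ a (i + 1)))) ∧ cTgt (cornerOrbit β₀ a n) ∈ I ∧ ((E.IsStartCorner a ∧ E₁.IsStartCorner a' ∧ ∀ m k : ℕ, m ≤ n → (∀ i < k, cTgt (cornerOrbit β₁ a' i) ∉ I ∧ E₁.IsInnerFace (cFace (cornerOrbit β₁ a' (i + 1)))) → cornerOrbit β₁ a' k = cornerOrbit β₀ a m → ∑ i ∈ Finset.range k, turnOf β₁ (cornerOrbit β₁ a' i) ≠ ∑ i ∈ Finset.range m, turnOf β₀ (cornerOrbit β₀ a i)) ∨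 (∃ m k : ℕ, m < n ∧ (∀ i < k, cTgt (cornerOrbit β₁ a' i) ∉ I ∧ E₁.IsInnerFace (cFace (cornerOrbit β₁ a' (i + 1)))) ∧ cornerOrbit β₁ a' k = cornerOrbit β₀ a m ∧ ∑ i ∈ Finset.range k, turnOf β₁ (cornerOrbit β₁ a' i) = ∑ i ∈ Finset.range m, turnOf β₀ (cornerOrbit β₀ a i) ∧ infDist (meshPoint E.δ (cornerOrbit β₀ a m).1) D.carrierᶜ < 3 * η ∧ (((cTgt (cornerOrbit β₀ a m) ∈ β₀ ↔ cTgt (cornerOrbit β₀ a m) ∈ β₁) ∧ cornerOrbit β₁ a' (k + 1) = cornerOrbit β₀ a (m + 1) ∧ E.IsInnerFace (cFace (cornerOrbit β₀ a (m + 1))) ∧ ¬ E₁.IsInnerFace (cFace (cornerOrbit β₀ a (m + 1)))) ∨ (¬ (cTgt (cornerOrbit β₀ a m) ∈ β₀ ↔ cTgt (cornerOrbit β₀ a m) ∈ β₁) ∧ (∀ j j₀ : ℕ, m < j₀ → j₀ ≤ n → (∀ i < j, cTgt (cornerOrbit β₁ (cornerOrbit β₀ a m) i) ∉ I ∧ E₁.IsInnerFace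 (cFace (cornerOrbit β₁ (cornerOrbit β₀ a m) (i + 1)))) → cornerOrbit β₁ (cornerOrbit β₀ a m) j = cornerOrbit β₀ a j₀ → ∑ i ∈ Finset.range j, turnOf β₁ (cornerOrbit β₁ (cornerOrbit β₀ a m) i) ≠ ∑ i ∈ Finset.Ico m j₀, turnOf β₀ (cornerOrbit β₀ a i)) ∧ ∃ T : ℕ, (∀ i < T, cTgt (cornerOrbit β₁ (cornerOrbit β₀ a m) i) ∉ I ∧ E₁.IsInnerFace (cFace (cornerOrbit β₁ (cornerOrbit β₀ a m) (i + 1)))) ∧ (cTgt (cornerOrbit β₁ (cornerOrbit β₀ a m) T) ∈ I ∨ ¬ E₁.IsInnerFace (cFace (cornerOrbit β₁ (cornerOrbit β₀ a m) (T + 1)))))))) := by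
  intro D η hη
  obtain ⟨δ₁, hδ₁, hcollar⟩ := collarAgreement D η hη
  refine ⟨min δ₁ η, lt_min hδ₁ hη, ?_⟩
  intro E hEΩ hE hEδ v w ρ hηρ hv hw ω a a' E₁ β₀ β₁ I hE₁ hβ₀ hβ₁ hI hpair hfail
  subst hE₁ hβ₀ hβ₁ hI
  have hδ : 0 < E.δ := hE.delta_pos
  have hδ₁' : E.δ < δ₁ := lt_of_lt_of_le hEδ (min_le_left _ _)
  have hδη : E.δ ≤ η := (lt_of_lt_of_le hEδ (min_le_right _ _)).le
  -- agreement at deep corners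
  have hagree : ∀ x : Site 2, 3 * η ≤ infDist (meshPoint E.δ x) D.carrierᶜ → ∀ (k : Fin 4) (β : BondConfig (Site 2)),
      (cTgt (x, k) ∈ E.bcBondConfig ω ↔ cTgt (x, k) ∈ (shiftData E w).bcBondConfig ω) ∧
        E.IsInnerFace (cFace (nextCorner β (x, k))) ∧
        (shiftData E w).IsInnerFace (cFace (nextCorner β (x, k))) := fun x hx k β =>
    no_discrepancy_of_agree hδ.le (hcollar E hEΩ hE hδ₁' w hw ω x hx) k β
  have hinner : ∀ x : Site 2, 3 * η ≤ infDist (meshPoint E.δ x) D.carrierᶜ → ∀ f : Site 2,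
      IsCorner x f → E.IsInnerFace f ∧ (shiftData E w).IsInnerFace f := fun x hx =>
    (hcollar E hEΩ hE hδ₁' w hw ω x hx x (by rw [dist_self]; positivity)).2
  -- localise
  obtain ⟨n, hStr, hin, hloc⟩ := responseLocalisation (E.bcBondConfig ω) ((shiftData E w).bcBondConfig ω)
    E.IsInnerFace (shiftData E w).IsInnerFace {e | medialPoint E.δ e ∈ ball (meshPoint E.δ v) ρ} a a' hfail
  refine ⟨n, hStr, hin, ?_⟩
  rcases hloc with hinit | ⟨m, k, hmn, hStr₁, hek, hsum, hFS⟩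
  · -- INITIAL: only for the start pair
    rcases hpair with ⟨ha, ha'⟩ | ⟨rfl, -, -⟩
    · exact Or.inl ⟨ha, ha', hinit⟩
    · exact absurd (by simp) (hinit 0 0 (Nat.zero_le n) (fun i hi => absurd hi (Nat.not_lt_zero i)) rfl)
  · right
    -- the last synchronised corner is in the collar
    have hcol : infDist (meshPoint E.δ (cornerOrbit (E.bcBondConfig ω) a m).1) D.carrierᶜ < 3 * η := by
      by_contra hdeep
      rw [not_lt] at hdeep
      obtain ⟨hiff, hIn₀, hIn₁⟩ := hagree _ hdeep (cornerOrbit (E.bcBondConfig ω) a m).2 (E.bcBondConfig ω)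
      rw [Prod.mk.eta] at hiff hIn₁
      rcases hFS with ⟨-, -, -, hnot⟩ | ⟨hne, -⟩
      · exact hnot hIn₁
      · exact hne hiff
    refine ⟨m, k, hmn, hStr₁, hek, hsum, hcol, ?_⟩
    rcases hFS with hface | ⟨hne, hret⟩
    · exact Or.inl hface
    · refine Or.inr ⟨hne, hret, ?_⟩
      -- the run of the second dynamics from `e` ends: no idle cycling
      have hE₁ : (shiftData E w).IsZdAdmissible := isZdAdmissible_shiftData E w hE
      have hidle : ∀ p : Site 2 × Fin 4, (shiftData E w).IsInnerFace (cFace p) →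
          cTgt p ∉ {e | medialPoint E.δ e ∈ ball (meshPoint E.δ v) ρ} →
          nextCorner ((shiftData E w).bcBondConfig ω) p ≠ a' := by
        intro p hp hpI
        rcases hpair with ⟨-, ha'⟩ | ⟨rfl, haI, -⟩
        · exact nextCorner_ne_start hE₁ ha' hp
        · intro h
          apply hpI
          have : cTgt p = cSrc a := by rw [← h, cSrc_nextCorner]
          rw [this]
          exact haI
      have hIn₁a : (shiftData E w).IsInnerFace (cFace a') := by
        rcases hpair with ⟨-, ha'⟩ | ⟨rfl, haI, -⟩
        · exact ha'.isOutEdge.1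
        · exact (hinner a.1 (deep_of_cSrc_mem_ball hδ.le hδη hηρ hv haI) _ (isCorner_cFace a)).2
      obtain ⟨T, hrun, hend⟩ := exists_runEnd ((shiftData E w).bcBondConfig ω) (shiftData E w).IsInnerFace
        {e | medialPoint E.δ e ∈ ball (meshPoint E.δ v) ρ} a' k (finite_innerCorners hE₁) hidle hIn₁a hStr₁
      rw [hek] at hrun hend
      exact ⟨T, hrun, hend⟩

end

end Summit.CriticalPhenomena.CardyFormulaZ2.Cruxes.EdgePrecompact.QkzStripBoundaryArm
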